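import Summits.CriticalPhenomena.SAWScalingLimit.Theses.SAWTensorRG
import Summits.CriticalPhenomena.SAWScalingLimit.Theses.SAWLoopFugacityFlow
import Summits.CriticalPhenomena.SAWScalingLimit.Theorems.IsingBoundaryRatio.Negative.IsingBoundaryRatioNormalisation
import Literature.Probability.RandomPlanarGeometry.HullSubdomainPullback
import Literature.Probability.RandomPlanarGeometry.CaratheodoryHalfPlaneProofs
import Literature.Probability.RandomPlanarGeometry.RestrictionHullsProofs
import Literature.Probability.RandomPlanarGeometry.RestrictionHullsRiemannProofs
import HarnessLib

/-!
# The value-ful avoidance crux implies the conformal-avoidance crux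
# (crux `ConformalAvoidance`, route `SAWTensorRG`, item stmt-CriticalPhenomena-7605;
# sibling crux `AvoidanceLimit`, route `SAWLoopFugacityFlow`, item stmt-CriticalPhenomena-10649)

`SAWTensorRG.ConformalAvoidance` asks, for hull-subdomain pairs `D ⊇ D'`, `E ⊇ E'` of Dobrushin
domains (same marked points, agreeing in balls around them), endpoint approximations `(a_δ, b_δ)` of
`D` and `(c_δ, d_δ)` of `E`, and a conformal `g : D → E` with boundary values `a ↦ E.pt 0`,
`b ↦ E.pt 1` and `g(D') = E'`, for ONE `r ∈ [0, ∞]` with `P_δ^D(range γ ⊆ cl D') → r` and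
`P_δ^E(range γ ⊆ cl E') → r` (full filter `δ → 0+`).

`SAWLoopFugacityFlow.AvoidanceLimit` gives the VALUE of such limits: for every chordal uniformizer
`φ : ℍ → D`, the pulled-back hull `A = closure (ℍ ∖ φ⁻¹ D')` and restriction data `(Φ_A, d = Φ'_A(0))`,
`P_δ^D(range γ ⊆ cl D') → d^{5/8}`.

This file proves, with no `sorry` and no unproved named fact, that the second implies the first
(`conformalAvoidance_of_avoidanceLimit`). The complex analysis is entirely in the tree:

* every Dobrushin domain has a chordal uniformizer (`MarkedDomain.exists_isChordalUniformizing_holds`);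
* ball agreement at the marked points makes `D'` a hull subdomain (`isHullSubdomain_of_conds`, reused from the
  IsingBoundaryRatio Negative lane), so
  the pulled-back hull is a `*`-hull (`IsStarHull.pullbackHull`, Jordan domains being simply connected,
  `JordanDomain.isSimplyConnected_holds`), whence a restriction map `Φ_A` and its derivative `Φ'_A(0)`
  exist (`IsStarHull.existsUnique_isRestrictionMap_holds`, `IsStarHull.exists_hasRestrictionDeriv_holds`);
* **transport**: `φ.trans g : ℍ → E` is a chordal uniformizer of `E` (boundary values compose along
  `𝓝[ℍ] 0 → 𝓝[D] a → 𝓝 (E.pt 0)` and `∞ → 𝓝[D] b → 𝓝 (E.pt 1)`), and its pulled-back hull for `E'`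
  is the SAME set `A` (`g` is injective on `D ⊇ D'` and `g(D') = E'`), so the same `(Φ_A, d)` serve
  `E`, and both avoidance probabilities tend to `d^{5/8}`.

Consequences recorded here: the conditional forms of the registered stubs `stub_avoidanceLimitExists`
(`avoidanceLimitExists_of_avoidanceLimit`) and `stub_conformalOfSimilarity`
(`conformalOfSimilarity_of_avoidanceLimit`) of line `birth`, and value-free conformal INVARIANCE of the
limits (`conformallyInvariantLimits_of_avoidanceLimit`). Kernel-checked crux lattice:
`AvoidanceLimit (10649) ⇒ ConformalAvoidance (7605)`; the companion file
`SAWTensorRGConformalAvoidanceStructure.lean` adds `ConformalAvoidance (7605) ⇒ AvoidanceCocycleLimit (1369)`.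
All statements [folklore]; context: Lawler–Schramm–Werner, *Conformal restriction: the chordal case*
(2003) §2 (hulls `𝒬*`, maps `Φ_A`); Lawler–Schramm–Werner, *On the scaling limit of planar
self-avoiding walk* (2004) §3.4.2, §4.1.
-/

noncomputable section

open scoped Topology ENNReal NNReal
open Filter Set MeasureTheory
open UpperHalfPlane (upperHalfPlaneSet)
open Literature.Probability.RandomPlanarGeometry Literature.Probability.LatticeModels
open Summit.CriticalPhenomena.SAWScalingLimit.Theses.SAWTensorRG (ConformalAvoidance)
open Summit.CriticalPhenomena.SAWScalingLimit.Theses.SAWLoopFugacityFlow (AvoidanceLimit)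
open Summit.CriticalPhenomena.SAWScalingLimit.Theorems.IsingBoundaryRatio.Negative (isHullSubdomain_of_conds)

namespace Summit.CriticalPhenomena.SAWScalingLimit.Theorems.ConformalAvoidance

/-! ### Hull subdomains and their restriction data -/

/-- **Restriction data exist.** For a hull subdomain `D'` of `D` and a chordal uniformizer `φ` of `D`,
the pulled-back hull `A = closure (ℍ ∖ φ⁻¹ D')` carries a restriction map `Φ_A : ℍ ∖ A → ℍ` with a
restriction derivative `d = Φ'_A(0)` (it is a `*`-hull; [LSW03] §2). [folklore] -/
theorem exists_restrictionData {D D' : DobrushinDomain} (hD' : D.IsHullSubdomain D')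
    {φ : ConformalEquiv upperHalfPlaneSet D.carrier} (hφ : D.IsChordalUniformizing φ) :
    ∃ (Φ : ConformalEquiv (upperHalfPlaneSet \ φ.pullbackHull D') upperHalfPlaneSet) (d : ℝ),
      IsRestrictionMap (φ.pullbackHull D') Φ ∧ HasRestrictionDeriv (φ.pullbackHull D') Φ d := by
  have hstar : IsStarHull (φ.pullbackHull D') :=
    IsStarHull.pullbackHull JordanDomain.isSimplyConnected_holds hφ hD'
  obtain ⟨Φ, hΦ, -⟩ := IsStarHull.existsUnique_isRestrictionMap_holds hstar
  obtain ⟨d, -, -, hd⟩ := IsStarHull.exists_hasRestrictionDeriv_holds hstar hΦ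
  exact ⟨Φ, d, hΦ, hd⟩

/-! ### Transport of the uniformizer along `g` -/

/-- **Transport of chordal uniformizers.** If `φ : ℍ → D` is a chordal uniformizer of `(D; a, b)` and
`g : D → E` is conformal with boundary values `a ↦ E.pt 0`, `b ↦ E.pt 1`, then `g ∘ φ : ℍ → E` is a
chordal uniformizer of `(E; E.pt 0, E.pt 1)` (limits compose through `𝓝[D] a`, `𝓝[D] b`). [folklore] -/
theorem isChordalUniformizing_trans {D E : DobrushinDomain}
    {φ : ConformalEquiv upperHalfPlaneSet D.carrier} (hφ : D.IsChordalUniformizing φ)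
    (g : ConformalEquiv D.carrier E.carrier)
    (hg0 : g.HasBoundaryValue (D.pt 0) (E.pt 0)) (hg1 : g.HasBoundaryValue (D.pt 1) (E.pt 1)) :
    E.IsChordalUniformizing (φ.trans g) := by
  refine ⟨?_, ?_⟩
  · have h1 : Tendsto φ (𝓝[upperHalfPlaneSet] 0) (𝓝[D.carrier] (D.pt 0)) :=
      tendsto_nhdsWithin_iff.2 ⟨hφ.1, eventually_nhdsWithin_of_forall fun z hz => φ.mapsTo hz⟩
    show Tendsto (fun z => (φ.trans g) z) _ _
    simp only [ConformalEquiv.trans_apply]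
    exact hg0.comp h1
  · have h1 : Tendsto φ (cocompact ℂ ⊓ 𝓟 upperHalfPlaneSet) (𝓝[D.carrier] (D.pt 1)) :=
      tendsto_nhdsWithin_iff.2 ⟨hφ.2,
        eventually_inf_principal.2 (Eventually.of_forall fun z hz => φ.mapsTo hz)⟩
    show Tendsto (fun z => (φ.trans g) z) _ _
    simp only [ConformalEquiv.trans_apply]
    exact hg1.comp h1

/-- **The pulled-back hulls agree.** With `g(D') = E'` (`D' ⊆ D`, `g` injective on `D`), the points of
`ℍ` mapped into `E'` by `g ∘ φ` are exactly those mapped into `D'` by `φ`. [folklore] -/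
theorem setOf_trans_mem_eq {D D' E E' : DobrushinDomain}
    (φ : ConformalEquiv upperHalfPlaneSet D.carrier) (g : ConformalEquiv D.carrier E.carrier)
    (hsub : D'.carrier ⊆ D.carrier) (hgD' : g '' D'.carrier = E'.carrier) :
    {z | z ∈ upperHalfPlaneSet ∧ (φ.trans g) z ∈ E'.carrier} =
      {z | z ∈ upperHalfPlaneSet ∧ φ z ∈ D'.carrier} := by
  ext z
  simp only [mem_setOf_eq, ConformalEquiv.trans_apply]
  refine and_congr_right fun hz => ?_
  have hφz : φ z ∈ D.carrier := φ.mapsTo hz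
  constructor
  · intro h
    rw [← hgD'] at h
    obtain ⟨w, hw, hgw⟩ := h
    have hwz : w = φ z := g.injOn (hsub hw) hφz hgw
    rw [← hwz]
    exact hw
  · intro h
    rw [← hgD']
    exact mem_image_of_mem _ h

/-- The pulled-back hull of `E' = g(D')` under the transported uniformizer `g ∘ φ` is the pulled-back
hull of `D'` under `φ`, in the inline spelling of `SAWLoopFugacityFlow.AvoidanceLimit`. [folklore] -/
theorem pullbackHull_eq_closure_trans {D D' E E' : DobrushinDomain}
    (φ : ConformalEquiv upperHalfPlaneSet D.carrier) (g : ConformalEquiv D.carrier E.carrier)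
    (hsub : D'.carrier ⊆ D.carrier) (hgD' : g '' D'.carrier = E'.carrier) :
    φ.pullbackHull D' =
      closure (upperHalfPlaneSet \ {z | z ∈ upperHalfPlaneSet ∧ (φ.trans g) z ∈ E'.carrier}) := by
  rw [setOf_trans_mem_eq φ g hsub hgD']
  rfl

/-! ### The reduction -/

/-- **`AvoidanceLimit ⇒ ConformalAvoidance`** (crux stmt-CriticalPhenomena-10649 of route
`SAWLoopFugacityFlow` implies crux stmt-CriticalPhenomena-7605 of route `SAWTensorRG`). Given the crux
data, pick a chordal uniformizer `φ` of `D` and restriction data `(Φ_A, d)` of the pulled-back hull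
`A` of `D'`; `AvoidanceLimit` gives `P_δ^D(range ⊆ cl D') → d^{5/8}`. The transported uniformizer
`g ∘ φ` of `E` has the same pulled-back hull for `E' = g(D')`, so `AvoidanceLimit` gives
`P_δ^E(range ⊆ cl E') → d^{5/8}` with the same `(Φ_A, d)`; take `r = d^{5/8}`. [folklore] -/
theorem conformalAvoidance_of_avoidanceLimit (h : AvoidanceLimit) : ConformalAvoidance := by
  intro D D' E E' a b c d g hab hcd hsub h0 h1 hball hEsub hE0 hE1 hEball hg0 hg1 hgD'
  obtain ⟨φ, hφ⟩ := MarkedDomain.exists_isChordalUniformizing_holds D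
  obtain ⟨Φ, dd, hΦ, hd⟩ :=
    exists_restrictionData (isHullSubdomain_of_conds hsub h0 h1 hball) hφ
  have limD := h D D' a b hab hsub h0 h1 hball φ hφ (φ.pullbackHull D') rfl Φ dd hΦ hd
  have limE := h E E' c d hcd hEsub hE0 hE1 hEball (φ.trans g)
    (isChordalUniformizing_trans hφ g hg0 hg1) (φ.pullbackHull D')
    (pullbackHull_eq_closure_trans φ g hsub hgD') Φ dd hΦ hd
  exact ⟨_, limD, limE⟩

/-! ### Consequences: the registered stubs of line `birth`, conditionally on `AvoidanceLimit` -/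

/-- **Existence of the full-filter avoidance limits from `AvoidanceLimit`**: the conditional form of the
registered stub `stub_avoidanceLimitExists` (= the sibling crux `SAWRestrictionRigidity.AvoidanceCocycleLimit`,
stmt-CriticalPhenomena-1369, verbatim): the limit exists and equals `Φ'_A(0)^{5/8}`. [folklore] -/
theorem avoidanceLimitExists_of_avoidanceLimit (h : AvoidanceLimit) :
    ∀ (D D' : DobrushinDomain) (a b : ℝ → Site 2), SAW.IsEndpointApprox D a b →
      D'.carrier ⊆ D.carrier → D'.pt 0 = D.pt 0 → D'.pt 1 = D.pt 1 →
      (∃ ε : ℝ, 0 < ε ∧ D'.carrier ∩ Metric.ball (D.pt 0) ε = D.carrier ∩ Metric.ball (D.pt 0) ε ∧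
        D'.carrier ∩ Metric.ball (D.pt 1) ε = D.carrier ∩ Metric.ball (D.pt 1) ε) →
      ∃ r : ENNReal,
        Tendsto (fun δ => ((SAW.law D.carrier δ (a δ) (b δ)).map (fun γ => γ.curve))
            (CurveClass.rangeSubset (closure D'.carrier))) (𝓝[>] 0) (𝓝 r) := by
  intro D D' a b hab hsub h0 h1 hball
  obtain ⟨φ, hφ⟩ := MarkedDomain.exists_isChordalUniformizing_holds D
  obtain ⟨Φ, dd, hΦ, hd⟩ :=
    exists_restrictionData (isHullSubdomain_of_conds hsub h0 h1 hball) hφ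
  exact ⟨_, h D D' a b hab hsub h0 h1 hball φ hφ (φ.pullbackHull D') rfl Φ dd hΦ hd⟩

/-- **Conformal invariance of the avoidance limit VALUES from `AvoidanceLimit`** (the statement
`ConformallyInvariantLimits` of the birth skeleton, literal): for crux data `(D, D'; a, b)`,
`(E, E'; c, d)`, `g`, any two limits `r₁`, `r₂` of the two avoidance probabilities coincide — both
families converge to the common `r` of `conformalAvoidance_of_avoidanceLimit`, and limits along the
proper filter `𝓝[>] 0` are unique. [folklore] -/
theorem conformallyInvariantLimits_of_avoidanceLimit (h : AvoidanceLimit) :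
    ∀ (D D' E E' : DobrushinDomain) (a b c d : ℝ → Site 2) (g : ConformalEquiv D.carrier E.carrier),
      SAW.IsEndpointApprox D a b → SAW.IsEndpointApprox E c d →
      D'.carrier ⊆ D.carrier → D'.pt 0 = D.pt 0 → D'.pt 1 = D.pt 1 →
      (∃ ε : ℝ, 0 < ε ∧ D'.carrier ∩ Metric.ball (D.pt 0) ε = D.carrier ∩ Metric.ball (D.pt 0) ε ∧
        D'.carrier ∩ Metric.ball (D.pt 1) ε = D.carrier ∩ Metric.ball (D.pt 1) ε) →
      E'.carrier ⊆ E.carrier → E'.pt 0 = E.pt 0 → E'.pt 1 = E.pt 1 →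
      (∃ ε : ℝ, 0 < ε ∧ E'.carrier ∩ Metric.ball (E.pt 0) ε = E.carrier ∩ Metric.ball (E.pt 0) ε ∧
        E'.carrier ∩ Metric.ball (E.pt 1) ε = E.carrier ∩ Metric.ball (E.pt 1) ε) →
      g.HasBoundaryValue (D.pt 0) (E.pt 0) → g.HasBoundaryValue (D.pt 1) (E.pt 1) →
      g '' D'.carrier = E'.carrier →
      ∀ r₁ r₂ : ENNReal,
        Tendsto (fun δ => ((SAW.law D.carrier δ (a δ) (b δ)).map (fun γ => γ.curve))
            (CurveClass.rangeSubset (closure D'.carrier))) (𝓝[>] 0) (𝓝 r₁) →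
        Tendsto (fun δ => ((SAW.law E.carrier δ (c δ) (d δ)).map (fun γ => γ.curve))
            (CurveClass.rangeSubset (closure E'.carrier))) (𝓝[>] 0) (𝓝 r₂) → r₁ = r₂ := by
  intro D D' E E' a b c d g hab hcd hsub h0 h1 hball hEsub hE0 hE1 hEball hg0 hg1 hgD' r₁ r₂ hr₁ hr₂
  obtain ⟨r, hrD, hrE⟩ := conformalAvoidance_of_avoidanceLimit h D D' E E' a b c d g hab hcd hsub h0
    h1 hball hEsub hE0 hE1 hEball hg0 hg1 hgD'
  exact (tendsto_nhds_unique hr₁ hrD).trans (tendsto_nhds_unique hrE hr₂)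

/-- **The residual N3 from `AvoidanceLimit`**: the conditional form of the registered stub
`stub_conformalOfSimilarity` (`AvoidanceLimitExists → SimilarityInvariantLimits →
ConformallyInvariantLimits`, literal) — under `AvoidanceLimit` its conclusion holds outright
(`conformallyInvariantLimits_of_avoidanceLimit`), so both antecedents are idle. [folklore] -/
theorem conformalOfSimilarity_of_avoidanceLimit (h : AvoidanceLimit) :
    (∀ (D D' : DobrushinDomain) (a b : ℝ → Site 2), SAW.IsEndpointApprox D a b →
       D'.carrier ⊆ D.carrier → D'.pt 0 = D.pt 0 → D'.pt 1 = D.pt 1 →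
       (∃ ε : ℝ, 0 < ε ∧ D'.carrier ∩ Metric.ball (D.pt 0) ε = D.carrier ∩ Metric.ball (D.pt 0) ε ∧
         D'.carrier ∩ Metric.ball (D.pt 1) ε = D.carrier ∩ Metric.ball (D.pt 1) ε) →
       ∃ r : ENNReal,
         Tendsto (fun δ => ((SAW.law D.carrier δ (a δ) (b δ)).map (fun γ => γ.curve))
             (CurveClass.rangeSubset (closure D'.carrier))) (𝓝[>] 0) (𝓝 r)) →
    (∀ (D D' E E' : DobrushinDomain) (a b c d : ℝ → Site 2) (g : ConformalEquiv D.carrier E.carrier),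
       (∃ (s θ : ℝ) (w : ℂ), 0 < s ∧ ∀ z ∈ D.carrier,
         g z = (s : ℂ) * Complex.exp ((θ : ℂ) * Complex.I) * z + w) →
       SAW.IsEndpointApprox D a b → SAW.IsEndpointApprox E c d →
       D'.carrier ⊆ D.carrier → D'.pt 0 = D.pt 0 → D'.pt 1 = D.pt 1 →
       (∃ ε : ℝ, 0 < ε ∧ D'.carrier ∩ Metric.ball (D.pt 0) ε = D.carrier ∩ Metric.ball (D.pt 0) ε ∧
         D'.carrier ∩ Metric.ball (D.pt 1) ε = D.carrier ∩ Metric.ball (D.pt 1) ε) →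
       E'.carrier ⊆ E.carrier → E'.pt 0 = E.pt 0 → E'.pt 1 = E.pt 1 →
       (∃ ε : ℝ, 0 < ε ∧ E'.carrier ∩ Metric.ball (E.pt 0) ε = E.carrier ∩ Metric.ball (E.pt 0) ε ∧
         E'.carrier ∩ Metric.ball (E.pt 1) ε = E.carrier ∩ Metric.ball (E.pt 1) ε) →
       g.HasBoundaryValue (D.pt 0) (E.pt 0) → g.HasBoundaryValue (D.pt 1) (E.pt 1) →
       g '' D'.carrier = E'.carrier →
       ∀ r₁ r₂ : ENNReal,
         Tendsto (fun δ => ((SAW.law D.carrier δ (a δ) (b δ)).map (fun γ => γ.curve))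
             (CurveClass.rangeSubset (closure D'.carrier))) (𝓝[>] 0) (𝓝 r₁) →
         Tendsto (fun δ => ((SAW.law E.carrier δ (c δ) (d δ)).map (fun γ => γ.curve))
             (CurveClass.rangeSubset (closure E'.carrier))) (𝓝[>] 0) (𝓝 r₂) → r₁ = r₂) →
    ∀ (D D' E E' : DobrushinDomain) (a b c d : ℝ → Site 2) (g : ConformalEquiv D.carrier E.carrier),
      SAW.IsEndpointApprox D a b → SAW.IsEndpointApprox E c d →
      D'.carrier ⊆ D.carrier → D'.pt 0 = D.pt 0 → D'.pt 1 = D.pt 1 →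
      (∃ ε : ℝ, 0 < ε ∧ D'.carrier ∩ Metric.ball (D.pt 0) ε = D.carrier ∩ Metric.ball (D.pt 0) ε ∧
        D'.carrier ∩ Metric.ball (D.pt 1) ε = D.carrier ∩ Metric.ball (D.pt 1) ε) →
      E'.carrier ⊆ E.carrier → E'.pt 0 = E.pt 0 → E'.pt 1 = E.pt 1 →
      (∃ ε : ℝ, 0 < ε ∧ E'.carrier ∩ Metric.ball (E.pt 0) ε = E.carrier ∩ Metric.ball (E.pt 0) ε ∧
        E'.carrier ∩ Metric.ball (E.pt 1) ε = E.carrier ∩ Metric.ball (E.pt 1) ε) →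
      g.HasBoundaryValue (D.pt 0) (E.pt 0) → g.HasBoundaryValue (D.pt 1) (E.pt 1) →
      g '' D'.carrier = E'.carrier →
      ∀ r₁ r₂ : ENNReal,
        Tendsto (fun δ => ((SAW.law D.carrier δ (a δ) (b δ)).map (fun γ => γ.curve))
            (CurveClass.rangeSubset (closure D'.carrier))) (𝓝[>] 0) (𝓝 r₁) →
        Tendsto (fun δ => ((SAW.law E.carrier δ (c δ) (d δ)).map (fun γ => γ.curve))
            (CurveClass.rangeSubset (closure E'.carrier))) (𝓝[>] 0) (𝓝 r₂) → r₁ = r₂ :=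
  fun _ _ => conformallyInvariantLimits_of_avoidanceLimit h

end Summit.CriticalPhenomena.SAWScalingLimit.Theorems.ConformalAvoidance

end
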